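import Summits.CriticalPhenomena.PercolationContinuityZ3.Theorems.PercNearOneGluingNoHeavyLowerTailThreePartitionJuntaCert
import HarnessLib.Audit

/-!
# `NoHeavyLowerTail` (crux stmt-CriticalPhenomena-4575), master-family hierarchy P3 (gen 38): BLOCK-LEVEL KLEITMAN inequalities for junta
# pattern sums, and the free half of a pure diagonal certificate (`κ = z_τ` always satisfies condition (ii))

Support file (seat `prim-masterthm-p3`; `--supports stmt-CriticalPhenomena-4575`; memo
`run/shared/lean/prim/prim-masterthm/FROM-prim-masterthm-p3-g38-PDC-STRUCTURE.md` §1–§2).  For a block `Q ⊆ ι`, a twist `τ` and families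
`𝔛, 𝔜, ℨ` of Q-parts, the pattern sum `Σ_{P ∈ cfgsIn Q} [qc₁P ∈ 𝔛][qc₂P ∈ 𝔜][qc₃P ∈ ℨ]` is `1/nRep` times a twisted three-partition count of the
junta lifts on the whole ground type (`sum_cfgsIn_ind₃_mul_nRep`), so the fibrewise four-functions inequality `teeT_le_deeT` (merging two copies
that carry UP-SETS, the third copy carrying an ARBITRARY family) descends to the block:
 * `sum_cfgsIn_ind_le₁₂`: `Σ_P [qc₁P ∈ 𝔘][qc₂P ∈ 𝔄][qc₃P ∈ ℨ] ≤ Σ_P [qc₂P ∈ 𝔘 ∩ 𝔄][qc₃P ∈ ℨ]` (`𝔘, 𝔄` up-sets, `ℨ` arbitrary);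
 * `sum_cfgsIn_ind_le₁₃`: `Σ_P [qc₁P ∈ 𝔘][qc₂P ∈ 𝔜][qc₃P ∈ 𝔅] ≤ Σ_P [qc₂P ∈ 𝔜][qc₃P ∈ 𝔘 ∩ 𝔅]` (`𝔘, 𝔅` up-sets, `𝔜` arbitrary).
Consequence (NORMAL FORM of certificates, half of it): with `zTau τ Q 𝔘 m = [m ∈ 𝔘]·#{P : qc₃P = m}` one has
`Σ_m zTau(m)[m ∈ 𝔇] = Σ_P [qc₃P ∈ 𝔘 ∩ 𝔇]`, and condition (ii) of `DiagCert` for `κ = zTau` is exactly `sum_cfgsIn_ind_le₁₃` with `𝔜 = ⊤`;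
hence **`diagCert_zTau`: for an up-set `𝔘`, condition (i) alone (`W(𝔄,𝔅) ≤ zTau(𝔄 ∩ 𝔅)`) makes `zTau` a certificate** and gives
`threePartNT τ (liftQ Q 𝔘) A B ≥ 0` for all up-sets `A, B` (`threePartNT_liftQ_nonneg_of_zTau`).  (Every certificate `κ` satisfies `κ ≥ zTau` on
up-sets and `κ = 0` off `𝔘` — memo §1; not needed here.)  HONEST LABEL: structural lemmas for the signature method; the general conjecture
(COMB-C3 / PDC for all blocks) stays OPEN. [this work]
-/

noncomputable section

open Finset
open scoped symmDiff Classical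

namespace Summit.CriticalPhenomena.PercolationContinuityZ3.Theorems.ThreePartition

variable {ι : Type*} [Fintype ι]

section BlockKleitman

variable (τ Q : Set ι)

/-- **Junta scaling of a three-slot pattern sum**: `#{x : x₁ ∈ liftQ 𝔛, x₂ ∈ liftQ 𝔜, x₃ ∈ liftQ ℨ} = nRep · Σ_P [qc₁P ∈ 𝔛][qc₂P ∈ 𝔜][qc₃P ∈ ℨ]`
(product decomposition over the block `Q`; any twist). [this work] -/
theorem sum_cfgsIn_ind₃_mul_nRep (𝔛 𝔜 ℨ : Set (Set ι)) :
    (∑ P ∈ cfgsIn Q, indZ (qc₁ τ Q P ∈ 𝔛 ∧ qc₂ τ Q P ∈ 𝔜 ∧ qc₃ τ Q P ∈ ℨ)) * nRep τ Q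
      = (triT τ (fun x₁ x₂ x₃ => x₁ ∈ liftQ Q 𝔛 ∧ x₂ ∈ liftQ Q 𝔜 ∧ x₃ ∈ liftQ Q ℨ) : ℤ) := by
  rw [triT_eq_sum_cfgsIn τ Q, Nat.cast_sum, sum_mul]
  refine sum_congr rfl fun P hP => ?_
  rw [mem_cfgsIn] at hP
  unfold nRep
  rw [← triT_and_const]
  exact_mod_cast triT_congr fun a b d => by
    rw [sdiff_union_mem_liftQ_iff 𝔛 (x := a) (qc₁_subset (τ := τ) hP.1), sdiff_union_mem_liftQ_iff 𝔜 (x := b) (qc₂_subset (τ := τ) hP.2.1),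
      sdiff_union_mem_liftQ_iff ℨ (x := d) (qc₃_subset τ Q P)]

/-- **Block Kleitman, merging copies 1 and 2** (copy 3 carries an arbitrary family): for up-sets `𝔘, 𝔄`,
`Σ_P [qc₁P ∈ 𝔘][qc₂P ∈ 𝔄][qc₃P ∈ ℨ] ≤ Σ_P [qc₂P ∈ 𝔘][qc₂P ∈ 𝔄][qc₃P ∈ ℨ]`. [this work] -/
theorem sum_cfgsIn_ind_le₁₂ {𝔘 𝔄 : Set (Set ι)} (h𝔘 : IsUpperSet 𝔘) (h𝔄 : IsUpperSet 𝔄) (ℨ : Set (Set ι)) :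
    ∑ P ∈ cfgsIn Q, indZ (qc₁ τ Q P ∈ 𝔘 ∧ qc₂ τ Q P ∈ 𝔄 ∧ qc₃ τ Q P ∈ ℨ)
      ≤ ∑ P ∈ cfgsIn Q, indZ (qc₂ τ Q P ∈ 𝔘 ∧ qc₂ τ Q P ∈ 𝔄 ∧ qc₃ τ Q P ∈ ℨ) := by
  have hn := nRep_pos τ Q
  have key : (∑ P ∈ cfgsIn Q, indZ (qc₁ τ Q P ∈ 𝔘 ∧ qc₂ τ Q P ∈ 𝔄 ∧ qc₃ τ Q P ∈ ℨ)) * nRep τ Q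
      ≤ (∑ P ∈ cfgsIn Q, indZ (qc₂ τ Q P ∈ 𝔘 ∧ qc₂ τ Q P ∈ 𝔄 ∧ qc₃ τ Q P ∈ ℨ)) * nRep τ Q := by
    have e2 : (∑ P ∈ cfgsIn Q, indZ (qc₂ τ Q P ∈ 𝔘 ∧ qc₂ τ Q P ∈ 𝔄 ∧ qc₃ τ Q P ∈ ℨ))
        = ∑ P ∈ cfgsIn Q, indZ (qc₁ τ Q P ∈ (Set.univ : Set (Set ι)) ∧ qc₂ τ Q P ∈ 𝔘 ∩ 𝔄 ∧ qc₃ τ Q P ∈ ℨ) :=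
      sum_congr rfl fun P _ => indZ_congr ⟨fun h => ⟨Set.mem_univ _, ⟨h.1, h.2.1⟩, h.2.2⟩, fun h => ⟨h.2.1.1, h.2.1.2, h.2.2⟩⟩
    rw [e2, sum_cfgsIn_ind₃_mul_nRep, sum_cfgsIn_ind₃_mul_nRep]
    have h1 : triT τ (fun x₁ x₂ x₃ => x₁ ∈ liftQ Q 𝔘 ∧ x₂ ∈ liftQ Q 𝔄 ∧ x₃ ∈ liftQ Q ℨ) = teeT τ (liftQ Q ℨ) (liftQ Q 𝔄) (liftQ Q 𝔘) := by
      unfold teeT; rw [triT_swap13]; exact triT_congr fun a b c => by tauto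
    have h2 : triT τ (fun x₁ x₂ x₃ => x₁ ∈ liftQ Q (Set.univ : Set (Set ι)) ∧ x₂ ∈ liftQ Q (𝔘 ∩ 𝔄) ∧ x₃ ∈ liftQ Q ℨ)
        = deeT τ (liftQ Q ℨ) (liftQ Q 𝔄 ∩ liftQ Q 𝔘) := by
      unfold deeT
      conv_lhs => rw [triT_swap13, triT_swap23]
      exact triT_congr fun a b c => by simp only [mem_liftQ, Set.mem_inter_iff, Set.mem_univ, true_and]; tauto
    rw [h1, h2]
    exact_mod_cast teeT_le_deeT τ (liftQ Q ℨ) (isUpperSet_liftQ Q h𝔄) (isUpperSet_liftQ Q h𝔘)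
  exact le_of_mul_le_mul_right key hn

/-- **Block Kleitman, merging copies 1 and 3** (copy 2 carries an arbitrary family): for up-sets `𝔘, 𝔅`,
`Σ_P [qc₁P ∈ 𝔘][qc₂P ∈ 𝔜][qc₃P ∈ 𝔅] ≤ Σ_P [qc₂P ∈ 𝔜][qc₃P ∈ 𝔘][qc₃P ∈ 𝔅]`. [this work] -/
theorem sum_cfgsIn_ind_le₁₃ {𝔘 𝔅 : Set (Set ι)} (h𝔘 : IsUpperSet 𝔘) (h𝔅 : IsUpperSet 𝔅) (𝔜 : Set (Set ι)) :
    ∑ P ∈ cfgsIn Q, indZ (qc₁ τ Q P ∈ 𝔘 ∧ qc₂ τ Q P ∈ 𝔜 ∧ qc₃ τ Q P ∈ 𝔅)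
      ≤ ∑ P ∈ cfgsIn Q, indZ (qc₂ τ Q P ∈ 𝔜 ∧ qc₃ τ Q P ∈ 𝔘 ∧ qc₃ τ Q P ∈ 𝔅) := by
  have hn := nRep_pos τ Q
  have key : (∑ P ∈ cfgsIn Q, indZ (qc₁ τ Q P ∈ 𝔘 ∧ qc₂ τ Q P ∈ 𝔜 ∧ qc₃ τ Q P ∈ 𝔅)) * nRep τ Q
      ≤ (∑ P ∈ cfgsIn Q, indZ (qc₂ τ Q P ∈ 𝔜 ∧ qc₃ τ Q P ∈ 𝔘 ∧ qc₃ τ Q P ∈ 𝔅)) * nRep τ Q := by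
    have e2 : (∑ P ∈ cfgsIn Q, indZ (qc₂ τ Q P ∈ 𝔜 ∧ qc₃ τ Q P ∈ 𝔘 ∧ qc₃ τ Q P ∈ 𝔅))
        = ∑ P ∈ cfgsIn Q, indZ (qc₁ τ Q P ∈ (Set.univ : Set (Set ι)) ∧ qc₂ τ Q P ∈ 𝔜 ∧ qc₃ τ Q P ∈ 𝔘 ∩ 𝔅) :=
      sum_congr rfl fun P _ => indZ_congr ⟨fun h => ⟨Set.mem_univ _, h.1, ⟨h.2.1, h.2.2⟩⟩, fun h => ⟨h.2.1, h.2.2.1, h.2.2.2⟩⟩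
    rw [e2, sum_cfgsIn_ind₃_mul_nRep, sum_cfgsIn_ind₃_mul_nRep]
    have h1 : triT τ (fun x₁ x₂ x₃ => x₁ ∈ liftQ Q 𝔘 ∧ x₂ ∈ liftQ Q 𝔜 ∧ x₃ ∈ liftQ Q 𝔅) = teeT τ (liftQ Q 𝔜) (liftQ Q 𝔘) (liftQ Q 𝔅) := by
      unfold teeT; rw [triT_swap12]; exact triT_congr fun a b c => by tauto
    have h2 : triT τ (fun x₁ x₂ x₃ => x₁ ∈ liftQ Q (Set.univ : Set (Set ι)) ∧ x₂ ∈ liftQ Q 𝔜 ∧ x₃ ∈ liftQ Q (𝔘 ∩ 𝔅))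
        = deeT τ (liftQ Q 𝔜) (liftQ Q 𝔘 ∩ liftQ Q 𝔅) := by
      unfold deeT
      conv_lhs => rw [triT_swap12]
      exact triT_congr fun a b c => by simp only [mem_liftQ, Set.mem_inter_iff, Set.mem_univ, true_and]
    rw [h1, h2]
    exact_mod_cast teeT_le_deeT τ (liftQ Q 𝔜) (isUpperSet_liftQ Q h𝔘) (isUpperSet_liftQ Q h𝔅)
  exact le_of_mul_le_mul_right key hn

end BlockKleitman

/-! ## The `z_τ`-weights: condition (ii) is free -/

section ZTau

variable (τ Q : Set ι) (𝔘 : Set (Set ι))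

/-- The **`z_τ`-weight** of a Q-part `m`: the number of patterns whose twisted third part is `m`, if `m ∈ 𝔘` (else `0`);
numerically `[m ∈ 𝔘]·2^{|Q| − |m ∆ (τ ∩ Q)|}`. [this work] -/
def zTau (m : Set ι) : ℤ := ∑ P ∈ cfgsIn Q, indZ (qc₃ τ Q P = m ∧ m ∈ 𝔘)

/-- `zTau ≥ 0`. [this work] -/
theorem zTau_nonneg (m : Set ι) : 0 ≤ zTau τ Q 𝔘 m := sum_nonneg fun _ _ => indZ_nonneg _

/-- **The diagonal form of `zTau` is a pattern sum**: `Σ_{m ⊆ Q} zTau(m)·[m ∈ 𝔄 ∩ 𝔅] = Σ_P [qc₃P ∈ 𝔘][qc₃P ∈ 𝔄 ∩ 𝔅]`. [this work] -/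
theorem sum_zTau_mul_indZ (𝔄 𝔅 : Set (Set ι)) :
    ∑ m ∈ subsetsOf Q, zTau τ Q 𝔘 m * indZ (m ∈ 𝔄 ∧ m ∈ 𝔅)
      = ∑ P ∈ cfgsIn Q, indZ (qc₂ τ Q P ∈ (Set.univ : Set (Set ι)) ∧ qc₃ τ Q P ∈ 𝔘 ∧ qc₃ τ Q P ∈ 𝔄 ∩ 𝔅) := by
  unfold zTau
  simp_rw [sum_mul]
  rw [sum_comm]
  refine sum_congr rfl fun P _ => ?_
  rw [← sum_filter_add_sum_filter_not (subsetsOf Q) (fun m => m = qc₃ τ Q P)]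
  have hzero : ∑ m ∈ (subsetsOf Q).filter (fun m => ¬ m = qc₃ τ Q P), indZ (qc₃ τ Q P = m ∧ m ∈ 𝔘) * indZ (m ∈ 𝔄 ∧ m ∈ 𝔅) = 0 :=
    sum_eq_zero fun m hm => by
      rw [mem_filter] at hm
      rw [indZ_of_neg (fun h => hm.2 h.1.symm), zero_mul]
  have hone : (subsetsOf Q).filter (fun m => m = qc₃ τ Q P) = {qc₃ τ Q P} := by
    ext m; simp only [mem_filter, mem_subsetsOf, mem_singleton]
    exact ⟨fun h => h.2, fun h => ⟨h ▸ qc₃_subset τ Q P, h⟩⟩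
  rw [hzero, add_zero, hone, sum_singleton, ← indZ_and]
  exact indZ_congr ⟨fun h => ⟨Set.mem_univ _, h.1.2, h.2⟩, fun h => ⟨⟨rfl, h.2.1⟩, h.2.2⟩⟩

/-- The one-copy junta form splits as `2·Σ_P [qc₃P ∈ 𝔘 ∩ 𝔇] − Σ_P [qc₁P ∈ 𝔘][qc₃P ∈ 𝔇]`. [this work] -/
theorem sum_eJ_mul_indZ_eq (𝔄 𝔅 : Set (Set ι)) :
    ∑ P ∈ cfgsIn Q, eJ τ Q 𝔘 P * indZ (qc₃ τ Q P ∈ 𝔄 ∧ qc₃ τ Q P ∈ 𝔅)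
      = 2 * ∑ P ∈ cfgsIn Q, indZ (qc₂ τ Q P ∈ (Set.univ : Set (Set ι)) ∧ qc₃ τ Q P ∈ 𝔘 ∧ qc₃ τ Q P ∈ 𝔄 ∩ 𝔅)
        - ∑ P ∈ cfgsIn Q, indZ (qc₁ τ Q P ∈ 𝔘 ∧ qc₂ τ Q P ∈ (Set.univ : Set (Set ι)) ∧ qc₃ τ Q P ∈ 𝔄 ∩ 𝔅) := by
  unfold eJ
  rw [mul_sum, ← sum_sub_distrib]
  refine sum_congr rfl fun P _ => ?_
  have e1 : indZ (qc₃ τ Q P ∈ 𝔘) * indZ (qc₃ τ Q P ∈ 𝔄 ∧ qc₃ τ Q P ∈ 𝔅)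
      = indZ (qc₂ τ Q P ∈ (Set.univ : Set (Set ι)) ∧ qc₃ τ Q P ∈ 𝔘 ∧ qc₃ τ Q P ∈ 𝔄 ∩ 𝔅) := by
    rw [← indZ_and]
    exact indZ_congr ⟨fun h => ⟨Set.mem_univ _, h.1, h.2⟩, fun h => ⟨h.2.1, h.2.2⟩⟩
  have e2 : indZ (qc₁ τ Q P ∈ 𝔘) * indZ (qc₃ τ Q P ∈ 𝔄 ∧ qc₃ τ Q P ∈ 𝔅)
      = indZ (qc₁ τ Q P ∈ 𝔘 ∧ qc₂ τ Q P ∈ (Set.univ : Set (Set ι)) ∧ qc₃ τ Q P ∈ 𝔄 ∩ 𝔅) := by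
    rw [← indZ_and]
    exact indZ_congr ⟨fun h => ⟨h.1, Set.mem_univ _, h.2⟩, fun h => ⟨h.1, h.2.2⟩⟩
  rw [sub_mul, mul_assoc, e1, e2]

/-- **Condition (ii) is free for `κ = zTau`** (`𝔘` an up-set): `Σ_m zTau(m)[m ∈ 𝔄 ∩ 𝔅] ≤ Σ_P eJ(P)[qc₃P ∈ 𝔄 ∩ 𝔅]` for all up-sets `𝔄, 𝔅`
— the block Kleitman inequality merging copies 1 and 3. [this work] -/
theorem sum_zTau_le_sum_eJ (h𝔘 : IsUpperSet 𝔘) {𝔄 𝔅 : Set (Set ι)} (h𝔄 : IsUpperSet 𝔄) (h𝔅 : IsUpperSet 𝔅) :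
    ∑ m ∈ subsetsOf Q, zTau τ Q 𝔘 m * indZ (m ∈ 𝔄 ∧ m ∈ 𝔅) ≤ ∑ P ∈ cfgsIn Q, eJ τ Q 𝔘 P * indZ (qc₃ τ Q P ∈ 𝔄 ∧ qc₃ τ Q P ∈ 𝔅) := by
  rw [sum_zTau_mul_indZ, sum_eJ_mul_indZ_eq]
  have h := sum_cfgsIn_ind_le₁₃ τ Q h𝔘 (h𝔄.inter h𝔅) (Set.univ : Set (Set ι))
  have e : ∑ P ∈ cfgsIn Q, indZ (qc₂ τ Q P ∈ (Set.univ : Set (Set ι)) ∧ qc₃ τ Q P ∈ 𝔘 ∧ qc₃ τ Q P ∈ 𝔄 ∩ 𝔅)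
      = ∑ P ∈ cfgsIn Q, indZ (qc₂ τ Q P ∈ (Set.univ : Set (Set ι)) ∧ qc₃ τ Q P ∈ 𝔘 ∧ qc₃ τ Q P ∈ 𝔄 ∩ 𝔅) := rfl
  linarith

/-- **`zTau` is a certificate as soon as condition (i) holds** (`𝔘` an up-set). [this work] -/
theorem diagCert_zTau (h𝔘 : IsUpperSet 𝔘)
    (hi : ∀ 𝔄 𝔅 : Set (Set ι), IsUpperSet 𝔄 → IsUpperSet 𝔅 →
      ∑ P ∈ cfgsIn Q, cJ τ Q 𝔘 P * indZ (qc₂ τ Q P ∈ 𝔄 ∧ qc₃ τ Q P ∈ 𝔅) ≤ ∑ m ∈ subsetsOf Q, zTau τ Q 𝔘 m * indZ (m ∈ 𝔄 ∧ m ∈ 𝔅)) :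
    DiagCert τ Q 𝔘 (zTau τ Q 𝔘) :=
  ⟨fun m _ => zTau_nonneg τ Q 𝔘 m, hi, fun _ _ h𝔄 h𝔅 => sum_zTau_le_sum_eJ τ Q 𝔘 h𝔘 h𝔄 h𝔅⟩

/-- **The `z_τ`-class of the signature method**: if `W(𝔄, 𝔅) ≤ zTau(𝔄 ∩ 𝔅)` for all up-set signatures, then
`threePartNT τ (liftQ Q 𝔘) A B ≥ 0` for all up-sets `A, B` of the ground type. [this work] -/
theorem threePartNT_liftQ_nonneg_of_zTau (h𝔘 : IsUpperSet 𝔘)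
    (hi : ∀ 𝔄 𝔅 : Set (Set ι), IsUpperSet 𝔄 → IsUpperSet 𝔅 →
      ∑ P ∈ cfgsIn Q, cJ τ Q 𝔘 P * indZ (qc₂ τ Q P ∈ 𝔄 ∧ qc₃ τ Q P ∈ 𝔅) ≤ ∑ m ∈ subsetsOf Q, zTau τ Q 𝔘 m * indZ (m ∈ 𝔄 ∧ m ∈ 𝔅))
    {A B : Set (Set ι)} (hA : IsUpperSet A) (hB : IsUpperSet B) : 0 ≤ threePartNT τ (liftQ Q 𝔘) A B :=
  threePartNT_liftQ_nonneg_of_cert (diagCert_zTau τ Q 𝔘 h𝔘 hi) hA hB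

end ZTau

end Summit.CriticalPhenomena.PercolationContinuityZ3.Theorems.ThreePartition

end
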